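import Literature.AlgebraicGeometry.Motives.ZarhinHodgeGroupTransport
import Literature.AlgebraicGeometry.Motives.ZarhinHodgeGroupBlockDet
import Literature.AlgebraicGeometry.Motives.ZarhinHodgeGroupSkewSpan
import Literature.AlgebraicGeometry.Motives.PairedDecompositionTensorInvariance
import Literature.AlgebraicGeometry.Motives.HodgeStructureK3TypeHodgeGroupProofs
import Mathlib.FieldTheory.Minpoly.Field
import HarnessLib

/-!
# Zarhin's theorem `Hdg(T) = SO_K(T, Ψ)` / `U_K(T, Ψ)` on `ℚ`-points — the named fact `Zarhin1983_hodgeGroup_eq`, proved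

We discharge the named fact `HodgeStructure.Zarhin1983_hodgeGroup_eq`
(`HodgeStructureK3Type.lean`): for an irreducible `ℚ`-Hodge structure of K3 type `(V, H)` with
polarization `ψ` on a finite-dimensional `V`, an automorphism `g ∈ GL(V)` lies in the Hodge group
(the stabiliser of all Hodge tensors, Huybrechts p. 66 / Deligne, LNM 900, I Prop. 3.4) iff it
commutes with `K = End_Hdg(V)`, is a `ψ`-isometry, and — when every Hodge endomorphism is
`ψ`-self-adjoint (`K` totally real) — has `K`-determinant `1` (Huybrechts, *Lectures on K3
Surfaces*, Thm. 3.3.9; Zarhin 1983, Thm. 2.2.1 (totally real), Thm. 2.3.1 (CM)).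

The forward inclusion `Hdg(T) ⊂ SO_K(T)` / `U_K(T)` is the tree's
`Zarhin1983_hodgeGroup_eq.mp_of_mem` (`HodgeStructureK3TypeHodgeGroupProofs`), which also reduces
the fact to the reverse inclusion (`Zarhin1983_hodgeGroup_eq.of_reverse_inclusion`). Huybrechts
(p. 67): "The other inclusion is deduced from a comparison of dimensions" — Zarhin's Lie algebra
argument for the reductive algebraic group `Hdg(T)`. DEVIATION (recorded as required; Mathlib has
no algebraic groups): the tree proves the reverse inclusion `SO_K(T)(ℚ) ⊂ Hdg(T)(ℚ)` resp.
`U_K(T)(ℚ) ⊂ Hdg(T)(ℚ)` by an explicit, elementary version of the same Lie-algebra comparison,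
assembled here (`mem_hodgeGroup_of_commute_of_isometry`):

1. *Lie algebra.* `𝔥 ⊆ End_ℚ(V)`, the annihilator of all Hodge tensors under the derivation
   action, and its complex span `𝔥_ℂ` (= the complex annihilator, by descent;
   `ZarhinHodgeGroupLieAlgebra`, `…Descent`) contain the Hodge element and are stable under
   `Ad` of the Weil operator (`…TypePP`), commute with `K`, are `ψ_ℂ`-antisymmetric and closed
   under the `ψ`-positive adjoint (`…Positivity`), so the eigenspace blocks `T_σ`
   (`eigenBlock`, `…Blocks`) are `𝔥_ℂ`-irreducible; Zarhin's linear-algebra lemma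
   (`ZarhinLie.wedge_mem_of_irreducible`, `…_of_isotropic`; `…OrthogonalLie`, `…UnitaryLie`)
   gives `so(T_ε) ⊆ 𝔥_ℂ` resp. `gl(T_ε) ⊆ 𝔥_ℂ` at the distinguished block, and `Aut(ℂ)`-transport
   (`…AutC`, `…Transport`) at every block: all block wedges `x ∧ y`, `x ∈ T_σ`, `y ∈ T_σ̄`, lie in
   `𝔥_ℂ`. Since `ψ_ℂ`-antisymmetric block-preserving endomorphisms are sums of block wedges
   (`ZarhinLie.mem_span_wedge_of_skew`, `…SkewSpan`), `so_K(T,Ψ)_ℂ ⊆ 𝔥_ℂ` resp.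
   `u_K(T,Ψ)_ℂ ⊆ 𝔥_ℂ` (`mem_hodgeLieC_of_skew_of_forall_eigenBlock`) — the "comparison of
   dimensions".
2. *From the Lie algebra to the group.* For `g` as in the fact, `g_ℂ` is a `ψ_ℂ`-isometry
   preserving every block, of determinant `1` on each block in the totally real case
   (`det_restrict_baseChange_eq_one`, `…BlockDet`: `det(g_ℂ|T_σ) = σ(det_K g)`); in the CM case no
   block is self-conjugate. By the tree's `tensorSpaceActOver_eq_self_of_paired_decomposition`
   (`PairedDecompositionTensorInvariance`: `g_ℂ` is a product of hyperbolic rotations in / across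
   blocks — Cartan–Dieudonné and generation of `GL` by dilations — each fixing the tensors its
   antisymmetric block-preserving generator kills) `g_ℂ` fixes `ι t` for every Hodge tensor `t`,
   hence `g` fixes `t` (`ι` injective and natural): `g ∈ Hdg(T)(ℚ)`.

No definitions, no named facts; net debt `-1`.

## References

* [Huybrechts2016K3] D. Huybrechts, *Lectures on K3 Surfaces*, CUP (2016), Ch. 3: Thm. 3.3.9 and
  its proof (p. 67), Thm. 3.3.7, Cor. 3.3.6, Rem. 3.3.14.
* [Zarhin1983HodgeGroupsK3] Yu. G. Zarhin, Hodge groups of K3 surfaces, J. reine angew. Math. 341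
  (1983) 193–220, Thms. 2.2.1, 2.3.1 (cited through Huybrechts and van Geemen).
* [vanGeemen2008RealMultK3] B. van Geemen, Real multiplication on K3 surfaces and Kuga–Satake
  varieties, Michigan Math. J. 56 (2008), §2 (Lemma 2.5: `SO(T,ψ)_K(ℂ) ≅ ∏ SO(T_σ)`).
* [Deligne1982HodgeCycles] P. Deligne, Hodge cycles on abelian varieties, LNM 900, I Prop. 3.4.
-/

noncomputable section

open scoped TensorProduct

namespace Literature.AlgebraicGeometry.Motives

namespace HodgeStructure

universe u

variable {V : Type u} [AddCommGroup V] [Module ℚ V]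

/-- A rational `B`-isometry base-changes to a `B_ℂ`-isometry. [folklore] -/
theorem form_baseChange_baseChange_apply (B : LinearMap.BilinForm ℚ V) {g : V →ₗ[ℚ] V}
    (hiso : ∀ v w, B (g v) (g w) = B v w) (x y : ℂ ⊗[ℚ] V) :
    B.baseChange ℂ (g.baseChange ℂ x) (g.baseChange ℂ y) = B.baseChange ℂ x y := by
  induction x using TensorProduct.induction_on with
  | zero => simp only [map_zero, LinearMap.zero_apply]
  | tmul c v =>
    induction y using TensorProduct.induction_on with
    | zero => simp only [map_zero]
    | tmul c' w =>
      simp only [LinearMap.baseChange_tmul, LinearMap.BilinForm.baseChange_tmul, hiso]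
    | add y y' hy hy' => simp only [map_add, hy, hy']
  | add x x' hx hx' => simp only [map_add, LinearMap.add_apply, hx, hx']

section Reverse

variable [Module.Finite ℚ V] [HodgeTensorFacts.{u, u}] {H : HodgeStructure V 2}

omit [HodgeTensorFacts.{u, u}] in
/-- **The blocks `T_σ` are independent** (`V_ℂ = ⊕_σ T_σ` is direct, Huybrechts Rem. 3.3.14
(iii)): `T_σ ⊆ Eig_{σ(θ)}(θ_ℂ)` for a primitive element `θ` of `E`, `σ ↦ σ(θ)` is injective, and
eigenspaces for distinct eigenvalues are independent. [cite: Huybrechts2016K3, Rem. 3.3.14 (iii)] -/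
theorem iSupIndep_eigenBlock (hirr : H.IsIrreducible) (hK3 : H.IsOfK3Type) :
    iSupIndep fun σ : H.endAlg →+* ℂ => H.eigenBlock σ := by
  have hF : IsField H.endAlg := (Zarhin1983_endAlg_isField_holds H hirr hK3).1
  obtain ⟨θ, hgen⟩ := exists_forall_eq_aeval hF
  have key : ∀ (ρ : H.endAlg →+* ℂ) (p : Polynomial ℚ),
      ρ (Polynomial.aeval θ p) = Polynomial.aeval (ρ θ) p := fun ρ p => by
    have h1 := Polynomial.aeval_algHom_apply ρ.toRatAlgHom θ p
    rw [RingHom.toRatAlgHom_apply, RingHom.toRatAlgHom_apply] at h1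
    exact h1.symm
  have hinj : Function.Injective fun σ : H.endAlg →+* ℂ => σ θ := by
    intro σ τ h
    refine RingHom.ext fun b => ?_
    obtain ⟨p, rfl⟩ := hgen b
    have h' : σ θ = τ θ := h
    rw [key σ, key τ, h']
  have hle : ∀ σ : H.endAlg →+* ℂ,
      H.eigenBlock σ ≤ Module.End.eigenspace ((θ : Module.End ℚ V).baseChange ℂ) (σ θ) :=
    fun σ x hx => Module.End.mem_eigenspace_iff.2 ((H.mem_eigenBlock_iff σ x).1 hx θ)
  exact ((Module.End.eigenspaces_iSupIndep ((θ : Module.End ℚ V).baseChange ℂ)).comp hinj).mono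
    fun σ => hle σ

omit [HodgeTensorFacts.{u, u}] in
/-- **CM case: no block is self-conjugate.** If some Hodge endomorphism `a₀` is not
`ψ`-self-adjoint then `σ̄ ≠ σ` for every embedding `σ : E → ℂ`: with `a₁` the `ψ`-adjoint of `a₀`,
`σ(a₁) = conj σ(a₀)` (Zarhin; Huybrechts Thm. 3.3.7, `Zarhin1983_adjoint_eq_conj_holds`), so
`σ̄ = σ` would force `a₁ = a₀` (`σ` is injective on the field `E`).
[cite: Huybrechts2016K3, Thm. 3.3.7] -/
theorem starRingEnd_comp_ne_of_not_isAdjointPair' (hirr : H.IsIrreducible) (hK3 : H.IsOfK3Type)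
    (ψ : H.Polarization) {a₀ : H.endAlg}
    (ha₀ : ¬ LinearMap.IsAdjointPair ψ.form ψ.form (a₀ : Module.End ℚ V) (a₀ : Module.End ℚ V))
    (σ : H.endAlg →+* ℂ) : (starRingEnd ℂ).comp σ ≠ σ := by
  intro h
  obtain ⟨hex, hconj⟩ := Zarhin1983_adjoint_eq_conj_holds H hirr hK3 ψ
  obtain ⟨a₁, hadj⟩ := hex a₀
  have h1 : σ a₁ = σ a₀ := by
    rw [hconj a₀ a₁ hadj σ]
    exact RingHom.congr_fun h a₀
  letI : Field H.endAlg := (Zarhin1983_endAlg_isField_holds H hirr hK3).1.toField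
  have h2 : a₁ = a₀ := σ.injective h1
  rw [h2] at hadj
  exact ha₀ hadj

/-- **The "comparison of dimensions" (Huybrechts Thm. 3.3.9; Zarhin Thms. 2.2.1 / 2.3.1):
`so_K(T,Ψ) ⊗ ℂ ⊆ Lie(Hdg T) ⊗ ℂ` resp. `u_K(T,Ψ) ⊗ ℂ ⊆ Lie(Hdg T) ⊗ ℂ`.** Every
`ψ_ℂ`-antisymmetric endomorphism of `V_ℂ` preserving every block `T_σ` lies in the complexified
Lie algebra `𝔥_ℂ` of the Hodge group: it is a sum of block wedges `x ∧ y`, `x ∈ T_σ`, `y ∈ T_σ̄`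
(`ZarhinLie.mem_span_wedge_of_skew`), which lie in `𝔥_ℂ` by Zarhin's Lie algebra theorem at every
block (`wedge_mem_hodgeLieC_of_mem_eigenBlock`, totally real case `σ̄ = σ`;
`wedge_mem_hodgeLieC_of_mem_eigenBlock_conj`, CM case).
[cite: Huybrechts2016K3, Thm. 3.3.9 (p. 67)] [cite: Zarhin1983HodgeGroupsK3, Thms. 2.2.1, 2.3.1] -/
theorem mem_hodgeLieC_of_skew_of_forall_eigenBlock (hirr : H.IsIrreducible) (hK3 : H.IsOfK3Type)
    (ψ : H.Polarization) {Z : Module.End ℂ (ℂ ⊗[ℚ] V)}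
    (hZA : ∀ σ : H.endAlg →+* ℂ, ∀ x ∈ H.eigenBlock σ, Z x ∈ H.eigenBlock σ)
    (hZ : ∀ x y, ψ.form.baseChange ℂ (Z x) y + ψ.form.baseChange ℂ x (Z y) = 0) :
    Z ∈ H.hodgeLieC := by
  have hB : (ψ.form.baseChange ℂ).IsSymm := ⟨fun x y => ψ.form_baseChange_comm y x⟩
  have hBn : (ψ.form.baseChange ℂ).Nondegenerate :=
    ⟨fun x hx => ψ.eq_zero_of_forall_form_eq_zero hx,
      fun y hy => ψ.eq_zero_of_forall_form_eq_zero' hy⟩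
  have hmem := ZarhinLie.mem_span_wedge_of_skew (A := fun σ : H.endAlg →+* ℂ => H.eigenBlock σ)
    (bar := fun σ : H.endAlg →+* ℂ => (starRingEnd ℂ).comp σ) hB hBn
    (iSupIndep_eigenBlock hirr hK3) (iSup_eigenBlock_eq_top hirr hK3)
    (fun σ => starRingEnd_comp_comp H σ)
    (fun σ τ hτσ x hx y hy => form_eq_zero_of_mem_eigenBlock hirr hK3 ψ
      (fun h => hτσ (by rw [← h, starRingEnd_comp_comp])) hx hy) hZA hZ
  refine (Submodule.span_le.2 ?_) hmem
  rintro T ⟨σ, x, y, hx, hy, rfl⟩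
  by_cases hself : ∀ a : H.endAlg,
      LinearMap.IsAdjointPair ψ.form ψ.form (a : Module.End ℚ V) (a : Module.End ℚ V)
  · rw [starRingEnd_comp_eq_of_forall_isAdjointPair hirr hK3 ψ hself σ] at hy
    exact wedge_mem_hodgeLieC_of_mem_eigenBlock hirr hK3 ψ hself σ hx hy
  · push Not at hself
    obtain ⟨a₀, ha₀⟩ := hself
    exact wedge_mem_hodgeLieC_of_mem_eigenBlock_conj hirr hK3 ψ ha₀ σ hx hy

/-- **Zarhin's theorem, reverse inclusion `SO_K(T,Ψ)(ℚ) ⊂ Hdg(T)(ℚ)` / `U_K(T,Ψ)(ℚ) ⊂ Hdg(T)(ℚ)`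
(Huybrechts Thm. 3.3.9; Zarhin 1983, Thms. 2.2.1, 2.3.1).** Let `(V, H)` be an irreducible Hodge
structure of K3 type with polarization `ψ`, and `g ∈ GL(V)` an automorphism commuting with
`K = End_Hdg(V)`, preserving `ψ`, and — if every Hodge endomorphism is `ψ`-self-adjoint — of
`K`-determinant `1`. Then `g` fixes every Hodge tensor, i.e. `g ∈ H.hodgeGroup`. Proof: `g_ℂ` is a
`ψ_ℂ`-isometry preserving the paired orthogonal decomposition `V_ℂ = ⊕_σ T_σ`
(`T_σ ⟂ T_τ` unless `τ = σ̄`), with `det (g_ℂ|T_σ) = σ(det_K g) = 1` on self-conjugate blocks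
(`det_restrict_baseChange_eq_one`; in the CM case there are none,
`starRingEnd_comp_ne_of_not_isAdjointPair'`); the complexified Hodge tensor `ι t` is killed by
every `ψ_ℂ`-antisymmetric block-preserving endomorphism
(`mem_hodgeLieC_of_skew_of_forall_eigenBlock`, `mem_hodgeLieC_iff`), hence fixed by `g_ℂ`
(`tensorSpaceActOver_eq_self_of_paired_decomposition`), and `ι` is injective and natural
(`tensorSpaceToBaseChange_injective`, `tensorSpaceToBaseChange_tensorSpaceAct`).
[cite: Huybrechts2016K3, Thm. 3.3.9 (p. 67)] [cite: Zarhin1983HodgeGroupsK3, Thms. 2.2.1, 2.3.1] -/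
theorem mem_hodgeGroup_of_commute_of_isometry (hirr : H.IsIrreducible) (hK3 : H.IsOfK3Type)
    (ψ : H.Polarization) (g : V ≃ₗ[ℚ] V)
    (hcomm : ∀ a : H.endAlg, (a : Module.End ℚ V) ∘ₗ (g : V →ₗ[ℚ] V) = (g : V →ₗ[ℚ] V) ∘ₗ a)
    (hiso : ∀ v w : V, ψ.form (g v) (g w) = ψ.form v w)
    (hdet : (∀ a : H.endAlg,
        LinearMap.IsAdjointPair ψ.form ψ.form (a : Module.End ℚ V) (a : Module.End ℚ V)) →
      ∃ g' : V →ₗ[Subalgebra.center ℚ H.endAlg] V,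
        ⇑g' = ⇑g ∧ LinearMap.det g' = (1 : Subalgebra.center ℚ H.endAlg)) :
    g ∈ H.hodgeGroup := by
  classical
  have hF : IsField H.endAlg := (Zarhin1983_endAlg_isField_holds H hirr hK3).1
  haveI : Module.Finite ℚ H.endAlg := finiteDimensional_endAlg H
  letI : Fintype (H.endAlg →+* ℂ) := Fintype.ofEquiv (H.endAlg →ₐ[ℚ] ℂ) RingHom.equivRatAlgHom.symm
  have hB : (ψ.form.baseChange ℂ).IsSymm := ⟨fun x y => ψ.form_baseChange_comm y x⟩
  have hBn : (ψ.form.baseChange ℂ).Nondegenerate :=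
    ⟨fun x hx => ψ.eq_zero_of_forall_form_eq_zero hx,
      fun y hy => ψ.eq_zero_of_forall_form_eq_zero' hy⟩
  set gC : (ℂ ⊗[ℚ] V) ≃ₗ[ℂ] (ℂ ⊗[ℚ] V) := g.baseChange ℚ ℂ V V with hgC
  have hgorth : (ψ.form.baseChange ℂ).IsOrthogonal gC := fun x y =>
    form_baseChange_baseChange_apply ψ.form hiso x y
  have hgA : ∀ σ : H.endAlg →+* ℂ, ∀ x ∈ H.eigenBlock σ, gC x ∈ H.eigenBlock σ :=
    fun σ x hx => baseChange_mem_iInf_eigenspace σ hcomm hx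
  have hdet' : ∀ σ : H.endAlg →+* ℂ, (starRingEnd ℂ).comp σ = σ →
      LinearMap.det ((gC : ℂ ⊗[ℚ] V →ₗ[ℂ] ℂ ⊗[ℚ] V).restrict (hgA σ)) = 1 := by
    intro σ hσ
    by_cases hself : ∀ a : H.endAlg,
        LinearMap.IsAdjointPair ψ.form ψ.form (a : Module.End ℚ V) (a : Module.End ℚ V)
    · obtain ⟨g', hg', hdetg'⟩ := hdet hself
      exact det_restrict_baseChange_eq_one hF σ (g := (g : V →ₗ[ℚ] V)) (g' := g')
        (fun v => congrFun hg' v) hdetg' (hgA σ)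
    · exfalso
      push Not at hself
      obtain ⟨a₀, ha₀⟩ := hself
      exact starRingEnd_comp_ne_of_not_isAdjointPair' hirr hK3 ψ ha₀ σ hσ
  rw [mem_hodgeGroup_iff]
  intro a b p hab t ht
  apply tensorSpaceToBaseChange_injective
  rw [tensorSpaceToBaseChange_tensorSpaceAct]
  exact OrthogonalGeneration.tensorSpaceActOver_eq_self_of_paired_decomposition
    (A := fun σ : H.endAlg →+* ℂ => H.eigenBlock σ) (iSupIndep_eigenBlock hirr hK3)
    (iSup_eigenBlock_eq_top hirr hK3) (bar := fun σ : H.endAlg →+* ℂ => (starRingEnd ℂ).comp σ)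
    hB hBn
    (fun σ τ hτσ x hx y hy => form_eq_zero_of_mem_eigenBlock hirr hK3 ψ
      (fun h => hτσ (by rw [← h, starRingEnd_comp_comp])) hx hy)
    (fun σ => starRingEnd_comp_comp H σ) gC hgorth hgA hdet'
    (fun Z hZA hZ => (H.mem_hodgeLieC_iff Z).1
      (mem_hodgeLieC_of_skew_of_forall_eigenBlock hirr hK3 ψ hZA hZ) a b p hab t ht)

end Reverse

/-- **Zarhin (1983) / Huybrechts, *Lectures on K3 Surfaces*, Thm. 3.3.9, proved:** the named fact
`Zarhin1983_hodgeGroup_eq` — for an irreducible polarized Hodge structure of K3 type `(V, H, ψ)`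
with `V` finite-dimensional, `g ∈ GL(V)` lies in the Hodge group iff it commutes with
`K = End_Hdg(V)`, preserves `ψ`, and (when `K` is totally real, i.e. all of `K` is
`ψ`-self-adjoint) has `K`-determinant `1`: `Hdg(T) = SO_K(T, Ψ)` resp. `= U_K(T, Ψ)` on
`ℚ`-points. Forward inclusion: `Zarhin1983_hodgeGroup_eq.mp_of_mem`; reverse inclusion:
`mem_hodgeGroup_of_commute_of_isometry` (the tree's elementary Lie-algebra-to-group argument in
place of the printed "comparison of dimensions" for the algebraic group `Hdg(T)`).
[cite: Huybrechts2016K3, Thm. 3.3.9 (p. 67)] [cite: Zarhin1983HodgeGroupsK3, Thms. 2.2.1, 2.3.1] -/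
theorem Zarhin1983_hodgeGroup_eq_holds : Zarhin1983_hodgeGroup_eq.{u} := by
  refine Zarhin1983_hodgeGroup_eq.of_reverse_inclusion ?_
  intro V _ _ _ _ H hirr hK3 ψ g hcomm hiso hdet
  exact mem_hodgeGroup_of_commute_of_isometry hirr hK3 ψ g hcomm hiso hdet

end HodgeStructure

end Literature.AlgebraicGeometry.Motives

end
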